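import Summits.Ventures.QEC.Thresholds.ToricCodePhenomenologicalDecay
import Summits.Ventures.QEC.Thresholds.ToricCodePhenomenologicalLogical
import Summits.Ventures.QEC.Thresholds.ToricCodePhenomenologicalElementary
import HarnessLib

/-!
# Corollaries of the UNCONDITIONAL phenomenological threshold `p₀(5) = (5 - 2√6)/10 ≈ .0101`:
# decimal form, `PMF` vocabulary, exponential decay

Venture QEC, `Summits/Ventures/QEC/Thresholds/` (LADDER-QEC Q5; qec-lead D1). qec-lit-2's
`ToricCodePhenomenologicalElementary.lean` removes the hypothesis `h` from type-09's
`phenomThreshold_elementary`: `phenomThreshold_elementary_unconditional` — for every polynomially bounded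
schedule and every minimum-weight space-time decoder family the `T`-round toric memory experiment with
`q = p` has threshold `≥ p₀(5)` (Dumer–Kovalev–Pryadko irreducible clusters on the space-time code,
`ToricCodePhenomenologicalClusterBound.lean`, finite-size bound `ToricCode.phenomFailureProb_le_cluster`:
`Prob_fail ≤ 3L²T r^L/(5(1-r))`, `r = 10√(p(1-p))`). This theorem-only file (kernel axioms, no named
fact) adds the three standard companions in the cell's vocabulary: the decimal threshold statement
`phenomThreshold_0101` (`IsThresholdLowerBound … 0.0101`), the row-09 `PMF` form `phenom_hasThreshold_five`
(`HasThreshold` of `Decoder.logicalFailureProb` under `iidLaw (bitLaw p)` on all space-time links, via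
`ToricCodePhenomenologicalLogical.lean`), and DKLP's "decreases exponentially with `L`"
`phenom_decaysExponentially_five` (`DecaysExponentially` at every `0 ≤ p < p₀(5)`, via the generic
`decaysExponentially_of_eventually_abs_le`); each with its canonical instance (`T = L + 1`,
`Decoder.minWeight`). No Monte Carlo number here.

## References

* [DennisEtAl2002] Dennis–Kitaev–Landahl–Preskill, J. Math. Phys. 43 (2002) 4452, §4.3, §5.3
  eqs. (threshold_iso), (threshold_iso_num), (fail_iso) and the sentence after it.
* [DumerKovalevPryadko2015] I. Dumer, A. A. Kovalev, L. P. Pryadko, PRL 115 (2015) 050502, Thm. 2/3.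
-/

noncomputable section

namespace Summit.Ventures.QEC.Thresholds

open Filter Topology Finset Matrix
open scoped ENNReal NNReal
open Literature.InformationTheory.QuantumCodes
open Literature.InformationTheory.QuantumCodes.ToricCode
open Literature.Probability.RandomPlanarGeometry

namespace PhenomCluster

variable {L T : ℕ}

/-- Decimal form: **every `0 ≤ p ≤ .0101` is below threshold** for the toric memory experiment with
noisy measurement (`q = p`), unconditionally. [cite: DennisEtAl2002, §5.3 eq. (threshold_iso_num)] -/
theorem phenomThreshold_0101 {T : ℕ → ℕ} (hT : IsPolyBounded T)
    {D : (L : ℕ) → STDecoder (L + 1) (T L)}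
    (hD : ∀ L, (D L).IsMinWeight (stSyn (L + 1) (T L)) (stCycles (L + 1) (T L)) hammingNorm) :
    IsThresholdLowerBound (phenomFailureFamily T D) 0.0101 :=
  (phenomThreshold_elementary_unconditional hT hD).anti thresholdValue_five_bounds.1.le

/-- `HasThreshold` (row-09 `PMF` vocabulary) at `p₀(5)`, unconditional: the logical failure probability of
the `T(L)`-round toric memory experiment under i.i.d. faults of rate `p` on qubits and syndrome bits
tends to `0` for every `0 ≤ p < p₀(5)`. [cite: DennisEtAl2002, §4.3 and §5.3 eq. (threshold_iso)] -/
theorem phenom_hasThreshold_five {T : ℕ → ℕ} (hT : IsPolyBounded T)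
    {D : (L : ℕ) → STDecoder (L + 1) (T L)}
    (hD : ∀ L, (D L).IsMinWeight (stSyn (L + 1) (T L)) (stCycles (L + 1) (T L)) hammingNorm) :
    HasThreshold (fun L p => (D L).logicalFailureProb (stSyn (L + 1) (T L)) (stTrivial (L + 1) (T L))
      (iidLaw (bitLaw (min p.toNNReal 1) (min_le_right _ _)))) (thresholdValue 5) :=
  phenom_hasThreshold_of_isThresholdLowerBound (phenomThreshold_elementary_unconditional hT hD)
    ((thresholdValue_le_half _).trans (by norm_num))

/-- **Exponential decay below `p₀(5)`, unconditional**: for every polynomially bounded schedule and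
every minimum-weight space-time decoder family, the failure probability decays exponentially in `L`
at every `0 ≤ p < p₀(5)`. [cite: DennisEtAl2002, §5.3 (after eq. (fail_iso))] -/
theorem phenom_decaysExponentially_five {T : ℕ → ℕ} (hT : IsPolyBounded T)
    {D : (L : ℕ) → STDecoder (L + 1) (T L)}
    (hD : ∀ L, (D L).IsMinWeight (stSyn (L + 1) (T L)) (stCycles (L + 1) (T L)) hammingNorm)
    {p : ℝ} (hp₀ : 0 ≤ p) (hpp : p < thresholdValue 5) :
    DecaysExponentially (phenomFailureFamily T D) p := by
  have hp : p ≤ 1 / 2 := hpp.le.trans (thresholdValue_le_half 5)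
  have hp₁ : p ≤ 1 := hp.trans (by norm_num)
  have hlt : p * (1 - p) < thresholdValue 5 * (1 - thresholdValue 5) :=
    mul_one_sub_lt_mul_one_sub hpp (by linarith [thresholdValue_le_half (5 : ℝ)])
  have h4 : 4 * (5 : ℝ) ^ 2 * (p * (1 - p)) < 1 := by
    calc 4 * (5 : ℝ) ^ 2 * (p * (1 - p)) < 4 * (5 : ℝ) ^ 2 * (thresholdValue 5 * (1 - thresholdValue 5)) := by
          gcongr
      _ = 1 := four_mul_sq_mul_thresholdValue (by norm_num)
  set s := Real.sqrt (p * (1 - p)) with hs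
  set r : ℝ := 10 * s with hrdef
  have hpp' : 0 ≤ p * (1 - p) := mul_nonneg hp₀ (by linarith)
  have hr0 : 0 ≤ r := by rw [hrdef]; positivity
  have hr1 : r < 1 := by
    have hsq : r ^ 2 = 4 * (5 : ℝ) ^ 2 * (p * (1 - p)) := by
      rw [hrdef, mul_pow, hs, Real.sq_sqrt hpp']; ring
    have h' : r ^ 2 < 1 := by rw [hsq]; exact h4
    have := (sq_lt_one_iff_abs_lt_one r).1 h'
    rwa [abs_of_nonneg hr0] at this
  have h1r : 0 < 1 - r := by linarith
  obtain ⟨A, k, hA⟩ := hT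
  refine decaysExponentially_of_eventually_abs_le (A := 3 * A * r / ((5 : ℝ) * (1 - r)))
    (k := k + 2) hr0 hr1 (Filter.Eventually.of_forall fun L => ?_)
  have hnonneg : 0 ≤ phenomFailureFamily T D L p := by
    simp only [phenomFailureFamily, phenomFailureProb]
    exact Finset.sum_nonneg fun E _ => by
      rw [phenomenologicalWeight_self]
      exact bernoulliWeight_nonneg hp₀ hp₁ _
  rw [abs_of_nonneg hnonneg]
  have hb := ToricCode.phenomFailureProb_le_cluster (D L) (hD L) hp₀ hp hr1
  simp only [phenomFailureFamily]
  refine hb.trans ?_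
  push_cast
  have hTL : (T L : ℝ) ≤ A * ((L : ℝ) + 1) ^ k := hA L
  have hden : 0 < (5 : ℝ) * (1 - r) := by positivity
  rw [div_mul_eq_mul_div, div_mul_eq_mul_div, div_le_div_iff_of_pos_right hden, pow_succ]
  have hnum : 3 * ((L : ℝ) + 1) ^ 2 * (T L : ℝ) ≤ 3 * A * ((L : ℝ) + 1) ^ (k + 2) := by
    calc 3 * ((L : ℝ) + 1) ^ 2 * (T L : ℝ) ≤ 3 * ((L : ℝ) + 1) ^ 2 * (A * ((L : ℝ) + 1) ^ k) := by
          gcongr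
      _ = 3 * A * ((L : ℝ) + 1) ^ (k + 2) := by ring
  calc 3 * ((L : ℝ) + 1) ^ 2 * (T L : ℝ) * (r ^ L * r)
      ≤ 3 * A * ((L : ℝ) + 1) ^ (k + 2) * (r ^ L * r) :=
        mul_le_mul_of_nonneg_right hnum (by positivity)
    _ = 3 * A * r * ((L : ℝ) + 1) ^ (k + 2) * r ^ L := by ring

/-- The canonical instance: `T(L) = L + 1` rounds, canonical minimum-weight space-time decoders —
exponential decay at every `0 ≤ p < p₀(5)`, unconditional. [cite: DennisEtAl2002, §5.3 (after eq. (fail_iso))] -/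
theorem decaysExponentially_stMinWeight_five {p : ℝ} (hp₀ : 0 ≤ p) (hpp : p < thresholdValue 5) :
    DecaysExponentially
      (phenomFailureFamily (fun L => L + 1)
        fun L => Decoder.minWeight (stSyn (L + 1) (L + 1)) hammingNorm) p :=
  phenom_decaysExponentially_five isPolyBounded_succ
    (fun L => ToricCode.isMinWeight_stMinWeight (L + 1) (L + 1)) hp₀ hpp

/-- `HasThreshold` at `p₀(5)` for the canonical minimum-weight space-time decoders (`T = L + 1`),
unconditional. [cite: DennisEtAl2002, §4.3 and §5.3 eq. (threshold_iso)] -/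
theorem hasThreshold_stMinWeight_five :
    HasThreshold (fun L p =>
      (Decoder.minWeight (stSyn (L + 1) (L + 1)) hammingNorm).logicalFailureProb
        (stSyn (L + 1) (L + 1)) (stTrivial (L + 1) (L + 1))
        (iidLaw (bitLaw (min p.toNNReal 1) (min_le_right _ _)))) (thresholdValue 5) :=
  phenom_hasThreshold_five (T := fun L => L + 1) isPolyBounded_succ
    fun L => ToricCode.isMinWeight_stMinWeight (L + 1) (L + 1)

end PhenomCluster

end Summit.Ventures.QEC.Thresholds

end
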